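import Literature.LinearAlgebra.Matrix.MoorePenroseInverse
import HarnessLib

/-!
# Identities for the Moore–Penrose inverse: scalars, transposes, isometries, diagonal,
# projector and rank-one matrices, Kronecker products, and MacDuffee's full-rank formula

Companion to `Literature/LinearAlgebra/Matrix/MoorePenroseInverse.lean` (Penrose's four equations
`IsMoorePenroseInverse`, the inverse `pinv`, uniqueness `IsMoorePenroseInverse.unique`).  We add
the classical closed-form rules, each proved by VERIFYING THE FOUR PENROSE EQUATIONS for the
displayed candidate and invoking uniqueness — exactly the method of the sources:

* `IsMoorePenroseInverse.smul`, `pinv_smul`, `pinv_real_smul` — `(λA)† = λ†A†` with `λ† = λ⁻¹`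
  (`0⁻¹ = 0`): Ben-Israel–Greville [BenIsraelGreville2003, Ch. 1 §3 eq. (8) and Lemma 1(c)]
  (the `{1}`-inverse statement; all four equations are checked here);
* `IsMoorePenroseInverse.transpose`, `pinv_transpose`, `IsMoorePenroseInverse.map_star`,
  `pinv_map_star` — `(Aᵀ)† = (A†)ᵀ`, `(Ā)† = (A†)‾` [BenIsraelGreville2003, Ch. 1 §6 Ex. 18(b),(c)];
* `IsMoorePenroseInverse.isometry_mul_mul`, `pinv_isometry_mul_mul`, `pinv_isometry_mul`,
  `pinv_mul_coisometry` — `(UAV)† = V* A† U*` for `U*U = I`, `VV* = I` (unitary `U`, `V` is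
  [BenIsraelGreville2003, Ch. 1 §6 Ex. 25]; the same computation only uses `U*U = I`, `VV* = I`);
* `isMoorePenroseInverse_diagonal`, `pinv_diagonal` — `diag(d)† = diag(d†)`
  [BenIsraelGreville2003, Ch. 1 §6 Ex. 22];
* `isMoorePenroseInverse_self_of_isHermitian_of_mul_self`,
  `pinv_eq_self_of_isHermitian_of_mul_self`,
  `pinv_mul_pinv`, `pinv_pinv_mul` — a Hermitian idempotent is its own Moore–Penrose inverse, in
  particular `(AA†)† = AA†`, `(A†A)† = A†A` [BenIsraelGreville2003, Ch. 1 §6 Ex. 20];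
* `pinv_vecMulVec` — the rank-one rule `(ab*)† = (a*a)†(b*b)† ba*`
  [BenIsraelGreville2003, Ch. 1 §6 Ex. 19(b)];
* `IsMoorePenroseInverse.kronecker`, `pinv_kronecker`, `kronecker_mul_pinv_kronecker`,
  `pinv_kronecker_mul_kronecker`, `pinv_kronecker_one`, `pinv_one_kronecker` —
  `(A ⊗ B)† = A† ⊗ B†`: Wang–Wei–Qiao [WangWeiQiao2018, Ch. 3 §3.3 Lemma 3.3.2 (5), (7), (8)]
  (for `{1}`-inverses: [BenIsraelGreville2003, Ch. 2 §1 Ex. 2 eq. (12)]);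
* `isMoorePenroseInverse_of_isUnit_conjTranspose_mul_self`,
  `pinv_eq_of_isUnit_conjTranspose_mul_self`,
  `pinv_mul_self_of_isUnit`, and the duals `…_of_isUnit_self_mul_conjTranspose`,
  `mul_pinv_self_of_isUnit` — full column (row) rank: `A† = (A*A)⁻¹A*` is a left inverse
  (`A† = A*(AA*)⁻¹` a right inverse) [BenIsraelGreville2003, Ch. 1 §3 Lemma 2, §6 Thm 5 eq. (19)
  with `G = I` resp. `F = I`];
* `pinv_mul_of_isUnit`, `pinv_mul_eq_macduffee` — MacDuffee: for a full-rank factorization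
  `A = FG` (`F*F`, `GG*` nonsingular) `A† = G†F† = G*(GG*)⁻¹(F*F)⁻¹F* = G*(F*AG*)⁻¹F*`
  [BenIsraelGreville2003, Ch. 1 §6 Thm 5 eqs. (17)–(19), Ex. 17 eq. (20)].

Everything is proved; there are no named facts.  Scalars are `RCLike 𝕜` as in the base file.
(`pinv (-A) = -pinv A` is `Literature.LinearAlgebra.TensorNetworks.pinv_neg` in
`TensorNetworks/QTTLaplacePseudoinverse.lean`; Penrose's solvability theorem for `AXB = D` is
`Literature/LinearAlgebra/Matrix/GeneralizedInverseLinearSystems.lean`.)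
-/

open Matrix
open scoped Kronecker ComplexOrder

namespace Literature.LinearAlgebra.Matrix.MoorePenrose

variable {𝕜 : Type*} [RCLike 𝕜]
variable {m n p q : Type*} [Fintype m] [Fintype n] [Fintype p] [Fintype q]

/-- [folklore] Cancellation of a middle pair: `P Q = 1 ⟹ (R P)(Q S) = R S`. -/
private theorem mul_mid_cancel {a b c d : Type*} [Fintype b] [Fintype c] [DecidableEq b]
    {R : Matrix a b 𝕜} {P : Matrix b c 𝕜} {Q : Matrix c b 𝕜} {S : Matrix b d 𝕜} (h : P * Q = 1) :
    R * P * (Q * S) = R * S := by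
  rw [Matrix.mul_assoc, ← Matrix.mul_assoc P, h, Matrix.one_mul]

/-! ### Scalar multiples -/

namespace IsMoorePenroseInverse

variable {A : Matrix m n 𝕜} {X : Matrix n m 𝕜}

/-- `(λA)† = λ†A†` with `λ† = λ⁻¹` for `λ ≠ 0` and `0† = 0` (Lean's `0⁻¹ = 0`).
[cite: BenIsraelGreville2003, Ch. 1 §3 eq. (8), Lemma 1(c)] -/
theorem smul (hX : IsMoorePenroseInverse A X) (c : 𝕜) :
    IsMoorePenroseInverse (c • A) (c⁻¹ • X) := by
  rcases eq_or_ne c 0 with rfl | hc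
  · rw [zero_smul, _root_.inv_zero, zero_smul]; exact isMoorePenroseInverse_zero
  have h1 : c • A * (c⁻¹ • X) = A * X := by
    rw [Matrix.smul_mul, Matrix.mul_smul, smul_smul, mul_inv_cancel₀ hc, one_smul]
  have h2 : c⁻¹ • X * (c • A) = X * A := by
    rw [Matrix.smul_mul, Matrix.mul_smul, smul_smul, inv_mul_cancel₀ hc, one_smul]
  refine ⟨?_, ?_, ?_, ?_⟩
  · rw [h1, Matrix.mul_smul, hX.mul_mul_self]
  · rw [h2, Matrix.mul_smul, hX.mul_mul_inv]
  · rw [h1]; exact hX.isHermitian_mul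
  · rw [h2]; exact hX.isHermitian_inv_mul

/-- `(Aᵀ)† = (A†)ᵀ`. [cite: BenIsraelGreville2003, Ch. 1 §6 Ex. 18(c)] -/
theorem transpose (hX : IsMoorePenroseInverse A X) : IsMoorePenroseInverse Aᵀ Xᵀ := by
  refine ⟨?_, ?_, ?_, ?_⟩
  · rw [← transpose_mul, ← transpose_mul, ← Matrix.mul_assoc, hX.mul_mul_self]
  · rw [← transpose_mul, ← transpose_mul, ← Matrix.mul_assoc, hX.mul_mul_inv]
  · rw [← transpose_mul]; exact hX.isHermitian_inv_mul.transpose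
  · rw [← transpose_mul]; exact hX.isHermitian_mul.transpose

/-- `(Ā)† = (A†)‾` (entrywise conjugation), from `(A*)† = (A†)*` and `(Aᵀ)† = (A†)ᵀ`.
[cite: BenIsraelGreville2003, Ch. 1 §6 Ex. 18(b),(c)] -/
theorem map_star (hX : IsMoorePenroseInverse A X) :
    IsMoorePenroseInverse (A.map star) (X.map star) := by
  have hA : Aᴴᵀ = A.map star := by ext i j; rfl
  have hX' : Xᴴᵀ = X.map star := by ext i j; rfl
  have h := hX.conjTranspose.transpose
  rwa [hA, hX'] at h

end IsMoorePenroseInverse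

section Scalar

variable [DecidableEq n]

/-- `(λA)† = λ⁻¹A†` (`0⁻¹ = 0`). [cite: BenIsraelGreville2003, Ch. 1 §3 eq. (8), Lemma 1(c)] -/
theorem pinv_smul (c : 𝕜) (A : Matrix m n 𝕜) : pinv (c • A) = c⁻¹ • pinv A :=
  (isMoorePenroseInverse_iff_eq_pinv.mp ((isMoorePenroseInverse_pinv A).smul c)).symm

/-- Real scalars: `(rA)† = r⁻¹A†`. [cite: BenIsraelGreville2003, Ch. 1 §3 eq. (8), Lemma 1(c)] -/
theorem pinv_real_smul (r : ℝ) (A : Matrix m n 𝕜) : pinv (r • A) = r⁻¹ • pinv A := by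
  have h1 : r • A = (r : 𝕜) • A := by ext i j; simp [RCLike.real_smul_eq_coe_mul]
  have h2 : r⁻¹ • pinv A = ((r : 𝕜))⁻¹ • pinv A := by
    ext i j; simp [RCLike.real_smul_eq_coe_mul]
  rw [h1, h2, pinv_smul]

/-- `(Ā)† = (A†)‾`. [cite: BenIsraelGreville2003, Ch. 1 §6 Ex. 18(b),(c)] -/
theorem pinv_map_star (A : Matrix m n 𝕜) : pinv (A.map star) = (pinv A).map star :=
  (isMoorePenroseInverse_iff_eq_pinv.mp (isMoorePenroseInverse_pinv A).map_star).symm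

variable [DecidableEq m]

/-- `(Aᵀ)† = (A†)ᵀ`. [cite: BenIsraelGreville2003, Ch. 1 §6 Ex. 18(c)] -/
theorem pinv_transpose (A : Matrix m n 𝕜) : pinv Aᵀ = (pinv A)ᵀ :=
  (isMoorePenroseInverse_iff_eq_pinv.mp (isMoorePenroseInverse_pinv A).transpose).symm

end Scalar

/-! ### Isometries: `(UAV)† = V* A† U*` -/

section Isometry

variable [DecidableEq m] [DecidableEq n]

/-- If `U` has orthonormal columns (`U*U = I`) and `V` orthonormal rows (`VV* = I`) then
`V* X U*` satisfies the Penrose equations for `UAV` whenever `X` does for `A`; for square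
(unitary) `U`, `V` this is `(UAV)† = V*A†U*`. [cite: BenIsraelGreville2003, Ch. 1 §6 Ex. 25] -/
theorem IsMoorePenroseInverse.isometry_mul_mul {A : Matrix m n 𝕜} {X : Matrix n m 𝕜}
    (hX : IsMoorePenroseInverse A X) {U : Matrix p m 𝕜} {V : Matrix n q 𝕜} (hU : Uᴴ * U = 1)
    (hV : V * Vᴴ = 1) : IsMoorePenroseInverse (U * A * V) (Vᴴ * X * Uᴴ) := by
  have e1 : U * A * V * (Vᴴ * X * Uᴴ) = U * (A * X) * Uᴴ := by
    rw [Matrix.mul_assoc Vᴴ, mul_mid_cancel hV]; simp only [Matrix.mul_assoc]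
  have e2 : Vᴴ * X * Uᴴ * (U * A * V) = Vᴴ * (X * A) * V := by
    rw [Matrix.mul_assoc U, mul_mid_cancel hU]; simp only [Matrix.mul_assoc]
  refine ⟨?_, ?_, ?_, ?_⟩
  · rw [e1]
    calc U * (A * X) * Uᴴ * (U * A * V) = U * (A * X) * Uᴴ * (U * (A * V)) := by
          rw [Matrix.mul_assoc U A V]
      _ = U * (A * X) * (A * V) := mul_mid_cancel hU
      _ = U * (A * X * A) * V := by simp only [Matrix.mul_assoc]
      _ = U * A * V := by rw [hX.mul_mul_self]
  · rw [e2]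
    calc Vᴴ * (X * A) * V * (Vᴴ * X * Uᴴ) = Vᴴ * (X * A) * V * (Vᴴ * (X * Uᴴ)) := by
          rw [Matrix.mul_assoc Vᴴ X Uᴴ]
      _ = Vᴴ * (X * A) * (X * Uᴴ) := mul_mid_cancel hV
      _ = Vᴴ * (X * A * X) * Uᴴ := by simp only [Matrix.mul_assoc]
      _ = Vᴴ * X * Uᴴ := by rw [hX.mul_mul_inv]
  · rw [e1]; exact isHermitian_mul_mul_conjTranspose U hX.isHermitian_mul
  · rw [e2]; exact isHermitian_conjTranspose_mul_mul V hX.isHermitian_inv_mul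

variable [DecidableEq q]

/-- `(UAV)† = V* A† U*` for `U*U = I`, `VV* = I` (in particular for unitary `U`, `V`).
[cite: BenIsraelGreville2003, Ch. 1 §6 Ex. 25] -/
theorem pinv_isometry_mul_mul (A : Matrix m n 𝕜) {U : Matrix p m 𝕜} {V : Matrix n q 𝕜}
    (hU : Uᴴ * U = 1) (hV : V * Vᴴ = 1) : pinv (U * A * V) = Vᴴ * pinv A * Uᴴ :=
  (isMoorePenroseInverse_iff_eq_pinv.mp
    ((isMoorePenroseInverse_pinv A).isometry_mul_mul hU hV)).symm

/-- `(UA)† = A† U*` for `U*U = I`. [cite: BenIsraelGreville2003, Ch. 1 §6 Ex. 25] -/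
theorem pinv_isometry_mul (A : Matrix m n 𝕜) {U : Matrix p m 𝕜} (hU : Uᴴ * U = 1) :
    pinv (U * A) = pinv A * Uᴴ := by
  have h := pinv_isometry_mul_mul A hU (V := (1 : Matrix n n 𝕜)) (by rw [conjTranspose_one,
    Matrix.mul_one])
  rwa [Matrix.mul_one, conjTranspose_one, Matrix.one_mul] at h

/-- `(AV)† = V* A†` for `VV* = I`. [cite: BenIsraelGreville2003, Ch. 1 §6 Ex. 25] -/
theorem pinv_mul_coisometry (A : Matrix m n 𝕜) {V : Matrix n q 𝕜} (hV : V * Vᴴ = 1) :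
    pinv (A * V) = Vᴴ * pinv A := by
  have h := pinv_isometry_mul_mul A (U := (1 : Matrix m m 𝕜)) (by rw [conjTranspose_one,
    Matrix.mul_one]) hV
  rwa [Matrix.one_mul, conjTranspose_one, Matrix.mul_one] at h

end Isometry

/-! ### Diagonal matrices, Hermitian idempotents, rank-one matrices -/

section Special

variable [DecidableEq n]

/-- `diag(d)† = diag(d†)`, `d†ᵢ = dᵢ⁻¹` (`0⁻¹ = 0`).
[cite: BenIsraelGreville2003, Ch. 1 §6 Ex. 22] -/
theorem isMoorePenroseInverse_diagonal (d : n → 𝕜) :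
    IsMoorePenroseInverse (diagonal d) (diagonal fun i => (d i)⁻¹) := by
  have hsa : ∀ i, IsSelfAdjoint (d i * (d i)⁻¹) := fun i => by
    rcases eq_or_ne (d i) 0 with h | h
    · rw [h, zero_mul]; exact IsSelfAdjoint.zero _
    · rw [mul_inv_cancel₀ h]; exact IsSelfAdjoint.one _
  refine ⟨?_, ?_, ?_, ?_⟩
  · rw [diagonal_mul_diagonal, diagonal_mul_diagonal]
    refine congr_arg diagonal (funext fun i => ?_)
    rcases eq_or_ne (d i) 0 with h | h
    · rw [h, mul_zero]
    · rw [mul_inv_cancel₀ h, one_mul]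
  · rw [diagonal_mul_diagonal, diagonal_mul_diagonal]
    refine congr_arg diagonal (funext fun i => ?_)
    rcases eq_or_ne (d i) 0 with h | h
    · rw [h, _root_.inv_zero, mul_zero]
    · rw [inv_mul_cancel₀ h, one_mul]
  · rw [diagonal_mul_diagonal]; exact isHermitian_diagonal_iff.mpr hsa
  · rw [diagonal_mul_diagonal]
    exact isHermitian_diagonal_iff.mpr fun i => by rw [mul_comm]; exact hsa i

/-- `diag(d)† = diag(dᵢ⁻¹)`. [cite: BenIsraelGreville2003, Ch. 1 §6 Ex. 22] -/
theorem pinv_diagonal (d : n → 𝕜) : pinv (diagonal d) = diagonal fun i => (d i)⁻¹ :=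
  (isMoorePenroseInverse_iff_eq_pinv.mp (isMoorePenroseInverse_diagonal d)).symm

omit [DecidableEq n] in
/-- A Hermitian idempotent (orthogonal projector) is its own Moore–Penrose inverse.
[cite: BenIsraelGreville2003, Ch. 1 §6 Ex. 20] -/
theorem isMoorePenroseInverse_self_of_isHermitian_of_mul_self {H : Matrix n n 𝕜}
    (hH : H.IsHermitian) (hP : H * H = H) : IsMoorePenroseInverse H H :=
  ⟨by rw [hP, hP], by rw [hP, hP], by rw [hP]; exact hH, by rw [hP]; exact hH⟩

/-- `H† = H` for a Hermitian idempotent `H`. [cite: BenIsraelGreville2003, Ch. 1 §6 Ex. 20] -/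
theorem pinv_eq_self_of_isHermitian_of_mul_self {H : Matrix n n 𝕜} (hH : H.IsHermitian)
    (hP : H * H = H) : pinv H = H :=
  (isMoorePenroseInverse_iff_eq_pinv.mp
    (isMoorePenroseInverse_self_of_isHermitian_of_mul_self hH hP)).symm

/-- `(A†A)† = A†A` (the projector `A†A` is Hermitian and idempotent).
[cite: BenIsraelGreville2003, Ch. 1 §6 Ex. 20] -/
theorem pinv_pinv_mul (A : Matrix m n 𝕜) : pinv (pinv A * A) = pinv A * A :=
  pinv_eq_self_of_isHermitian_of_mul_self (isHermitian_pinv_mul A) (pinv_mul_idem A)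

omit [DecidableEq n] in
/-- The rank-one rule `(ab*)† = (a*a)†(b*b)† ba*`: with `α = a*a = Σ|aᵢ|²`, `β = b*b`,
the matrix `α⁻¹β⁻¹ · ba*` satisfies the Penrose equations for `ab*` (`0⁻¹ = 0` covers `a = 0`
or `b = 0`). [cite: BenIsraelGreville2003, Ch. 1 §6 Ex. 19(b)] -/
theorem isMoorePenroseInverse_vecMulVec (a : m → 𝕜) (b : n → 𝕜) :
    IsMoorePenroseInverse (vecMulVec a (star b))
      (((star a ⬝ᵥ a)⁻¹ * (star b ⬝ᵥ b)⁻¹) • vecMulVec b (star a)) := by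
  by_cases hab : a = 0 ∨ b = 0
  · have hA : vecMulVec a (star b) = 0 := by
      ext i j; rcases hab with h | h <;> simp [vecMulVec_apply, h]
    have hX : ((star a ⬝ᵥ a)⁻¹ * (star b ⬝ᵥ b)⁻¹) • vecMulVec b (star a) = 0 := by
      ext i j; rcases hab with h | h <;> simp [vecMulVec_apply, h]
    rw [hA, hX]; exact isMoorePenroseInverse_zero
  simp only [not_or] at hab
  obtain ⟨ha, hb⟩ := hab
  have hα0 : star a ⬝ᵥ a ≠ 0 := fun h => ha (dotProduct_star_self_eq_zero.mp h)
  have hβ0 : star b ⬝ᵥ b ≠ 0 := fun h => hb (dotProduct_star_self_eq_zero.mp h)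
  have hαs : IsSelfAdjoint (star a ⬝ᵥ a) := by
    rw [isSelfAdjoint_iff, ← star_dotProduct]
  have hβs : IsSelfAdjoint (star b ⬝ᵥ b) := by
    rw [isSelfAdjoint_iff, ← star_dotProduct]
  have hHa : (vecMulVec a (star a)).IsHermitian := by
    unfold Matrix.IsHermitian; rw [conjTranspose_vecMulVec, star_star]
  have hHb : (vecMulVec b (star b)).IsHermitian := by
    unfold Matrix.IsHermitian; rw [conjTranspose_vecMulVec, star_star]
  -- the two products `A X = α⁻¹ · aa*` and `X A = β⁻¹ · bb*`
  have e1 : vecMulVec a (star b) * (((star a ⬝ᵥ a)⁻¹ * (star b ⬝ᵥ b)⁻¹) • vecMulVec b (star a)) =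
      (star a ⬝ᵥ a)⁻¹ • vecMulVec a (star a) := by
    rw [Matrix.mul_smul, vecMulVec_mul_vecMulVec, vecMulVec_smul, smul_smul, mul_assoc,
      inv_mul_cancel₀ hβ0, mul_one]
  have e2 : ((star a ⬝ᵥ a)⁻¹ * (star b ⬝ᵥ b)⁻¹) • vecMulVec b (star a) * vecMulVec a (star b) =
      (star b ⬝ᵥ b)⁻¹ • vecMulVec b (star b) := by
    rw [Matrix.smul_mul, vecMulVec_mul_vecMulVec, vecMulVec_smul, smul_smul, mul_right_comm,
      inv_mul_cancel₀ hα0, one_mul]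
  refine ⟨?_, ?_, ?_, ?_⟩
  · rw [e1, Matrix.smul_mul, vecMulVec_mul_vecMulVec, vecMulVec_smul, smul_smul,
      inv_mul_cancel₀ hα0, one_smul]
  · rw [e2, Matrix.smul_mul, Matrix.mul_smul, vecMulVec_mul_vecMulVec, vecMulVec_smul, smul_smul,
      smul_smul, mul_comm (star b ⬝ᵥ b)⁻¹ ((star a ⬝ᵥ a)⁻¹ * (star b ⬝ᵥ b)⁻¹), mul_assoc,
      inv_mul_cancel₀ hβ0, mul_one]
  · rw [e1]; exact hHa.smul hαs.inv₀
  · rw [e2]; exact hHb.smul hβs.inv₀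

/-- `(ab*)† = (a*a)⁻¹(b*b)⁻¹ · ba*` (`0⁻¹ = 0`).
[cite: BenIsraelGreville2003, Ch. 1 §6 Ex. 19(b)] -/
theorem pinv_vecMulVec (a : m → 𝕜) (b : n → 𝕜) :
    pinv (vecMulVec a (star b)) = ((star a ⬝ᵥ a)⁻¹ * (star b ⬝ᵥ b)⁻¹) • vecMulVec b (star a) :=
  (isMoorePenroseInverse_iff_eq_pinv.mp (isMoorePenroseInverse_vecMulVec a b)).symm

variable [DecidableEq m]

/-- `(AA†)† = AA†` (the projector `AA†` is Hermitian and idempotent).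
[cite: BenIsraelGreville2003, Ch. 1 §6 Ex. 20] -/
theorem pinv_mul_pinv (A : Matrix m n 𝕜) : pinv (A * pinv A) = A * pinv A :=
  pinv_eq_self_of_isHermitian_of_mul_self (isHermitian_mul_pinv A) (mul_pinv_idem A)

end Special

/-! ### Kronecker products: `(A ⊗ B)† = A† ⊗ B†` -/

section KroneckerProduct

/-- If `X`, `Y` satisfy the Penrose equations for `A`, `B` then `X ⊗ Y` satisfies them for
`A ⊗ B` (mixed-product rule and `(A ⊗ B)* = A* ⊗ B*`).
[cite: WangWeiQiao2018, Ch. 3 §3.3 Lemma 3.3.2 (5), (7), (8)]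
[cite: BenIsraelGreville2003, Ch. 2 §1 Ex. 2 eq. (12)] -/
theorem IsMoorePenroseInverse.kronecker {A : Matrix m n 𝕜} {X : Matrix n m 𝕜} {B : Matrix p q 𝕜}
    {Y : Matrix q p 𝕜} (hX : IsMoorePenroseInverse A X) (hY : IsMoorePenroseInverse B Y) :
    IsMoorePenroseInverse (A ⊗ₖ B) (X ⊗ₖ Y) := by
  refine ⟨?_, ?_, ?_, ?_⟩
  · rw [← mul_kronecker_mul, ← mul_kronecker_mul, hX.mul_mul_self, hY.mul_mul_self]
  · rw [← mul_kronecker_mul, ← mul_kronecker_mul, hX.mul_mul_inv, hY.mul_mul_inv]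
  · unfold Matrix.IsHermitian
    rw [← mul_kronecker_mul, conjTranspose_kronecker, hX.isHermitian_mul.eq, hY.isHermitian_mul.eq]
  · unfold Matrix.IsHermitian
    rw [← mul_kronecker_mul, conjTranspose_kronecker, hX.isHermitian_inv_mul.eq,
      hY.isHermitian_inv_mul.eq]

variable [DecidableEq n] [DecidableEq q]

/-- `(A ⊗ B)† = A† ⊗ B†`. [cite: WangWeiQiao2018, Ch. 3 §3.3 Lemma 3.3.2 (8)] -/
theorem pinv_kronecker (A : Matrix m n 𝕜) (B : Matrix p q 𝕜) :
    pinv (A ⊗ₖ B) = pinv A ⊗ₖ pinv B :=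
  (isMoorePenroseInverse_iff_eq_pinv.mp
    ((isMoorePenroseInverse_pinv A).kronecker (isMoorePenroseInverse_pinv B))).symm

/-- `(A ⊗ B)(A ⊗ B)† = AA† ⊗ BB†`. [cite: WangWeiQiao2018, Ch. 3 §3.3 Lemma 3.3.2 (5), (8)] -/
theorem kronecker_mul_pinv_kronecker (A : Matrix m n 𝕜) (B : Matrix p q 𝕜) :
    A ⊗ₖ B * pinv (A ⊗ₖ B) = (A * pinv A) ⊗ₖ (B * pinv B) := by
  rw [pinv_kronecker, ← mul_kronecker_mul]

/-- `(A ⊗ B)†(A ⊗ B) = A†A ⊗ B†B`. [cite: WangWeiQiao2018, Ch. 3 §3.3 Lemma 3.3.2 (5), (8)] -/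
theorem pinv_kronecker_mul_kronecker (A : Matrix m n 𝕜) (B : Matrix p q 𝕜) :
    pinv (A ⊗ₖ B) * (A ⊗ₖ B) = (pinv A * A) ⊗ₖ (pinv B * B) := by
  rw [pinv_kronecker, ← mul_kronecker_mul]

/-- `(A ⊗ I)† = A† ⊗ I`. [cite: WangWeiQiao2018, Ch. 3 §3.3 Lemma 3.3.2 (8)] -/
theorem pinv_kronecker_one (A : Matrix m n 𝕜) :
    pinv (A ⊗ₖ (1 : Matrix q q 𝕜)) = pinv A ⊗ₖ (1 : Matrix q q 𝕜) := by
  rw [pinv_kronecker, pinv_one]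

/-- `(I ⊗ B)† = I ⊗ B†`. [cite: WangWeiQiao2018, Ch. 3 §3.3 Lemma 3.3.2 (8)] -/
theorem pinv_one_kronecker (B : Matrix p q 𝕜) :
    pinv ((1 : Matrix n n 𝕜) ⊗ₖ B) = (1 : Matrix n n 𝕜) ⊗ₖ pinv B := by
  rw [pinv_kronecker, pinv_one]

end KroneckerProduct

/-! ### Full rank: left/right inverses and MacDuffee's formula -/

section FullRank

variable [DecidableEq n]

/-- Full column rank: if `A*A` is nonsingular then `(A*A)⁻¹A*` satisfies the Penrose equations
(and is a left inverse of `A`).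
[cite: BenIsraelGreville2003, Ch. 1 §6 Thm 5 eq. (19) with G = I; Ch. 1 §3 Lemma 2(a)] -/
theorem isMoorePenroseInverse_of_isUnit_conjTranspose_mul_self {A : Matrix m n 𝕜}
    (h : IsUnit (Aᴴ * A)) : IsMoorePenroseInverse A ((Aᴴ * A)⁻¹ * Aᴴ) := by
  have hdet : IsUnit (Aᴴ * A).det := (isUnit_iff_isUnit_det _).mp h
  have hL : (Aᴴ * A)⁻¹ * Aᴴ * A = 1 := by rw [Matrix.mul_assoc, nonsing_inv_mul _ hdet]
  refine ⟨?_, ?_, ?_, ?_⟩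
  · rw [Matrix.mul_assoc A, hL, Matrix.mul_one]
  · rw [hL, Matrix.one_mul]
  · rw [← Matrix.mul_assoc]
    exact isHermitian_mul_mul_conjTranspose A (isHermitian_conjTranspose_mul_self A).inv
  · rw [hL]; exact isHermitian_one

/-- Full column rank: `A† = (A*A)⁻¹A*`.
[cite: BenIsraelGreville2003, Ch. 1 §6 Thm 5 eq. (19) with G = I] -/
theorem pinv_eq_of_isUnit_conjTranspose_mul_self {A : Matrix m n 𝕜} (h : IsUnit (Aᴴ * A)) :
    pinv A = (Aᴴ * A)⁻¹ * Aᴴ :=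
  (isMoorePenroseInverse_iff_eq_pinv.mp
    (isMoorePenroseInverse_of_isUnit_conjTranspose_mul_self h)).symm

/-- Full column rank: `A†A = I` (the Moore–Penrose inverse is a left inverse).
[cite: BenIsraelGreville2003, Ch. 1 §3 Lemma 2(a)] -/
theorem pinv_mul_self_of_isUnit {A : Matrix m n 𝕜} (h : IsUnit (Aᴴ * A)) : pinv A * A = 1 := by
  rw [pinv_eq_of_isUnit_conjTranspose_mul_self h, Matrix.mul_assoc,
    nonsing_inv_mul _ ((isUnit_iff_isUnit_det _).mp h)]

section Row

variable [DecidableEq m]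

omit [DecidableEq n] in
/-- Full row rank: if `AA*` is nonsingular then `A*(AA*)⁻¹` satisfies the Penrose equations
(and is a right inverse of `A`).
[cite: BenIsraelGreville2003, Ch. 1 §6 Thm 5 eq. (19) with F = I; Ch. 1 §3 Lemma 2(b)] -/
theorem isMoorePenroseInverse_of_isUnit_self_mul_conjTranspose {A : Matrix m n 𝕜}
    (h : IsUnit (A * Aᴴ)) : IsMoorePenroseInverse A (Aᴴ * (A * Aᴴ)⁻¹) := by
  have hdet : IsUnit (A * Aᴴ).det := (isUnit_iff_isUnit_det _).mp h
  have hR : A * (Aᴴ * (A * Aᴴ)⁻¹) = 1 := by rw [← Matrix.mul_assoc, mul_nonsing_inv _ hdet]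
  refine ⟨?_, ?_, ?_, ?_⟩
  · rw [hR, Matrix.one_mul]
  · rw [Matrix.mul_assoc _ A, hR, Matrix.mul_one]
  · rw [hR]; exact isHermitian_one
  · exact isHermitian_conjTranspose_mul_mul A (isHermitian_mul_conjTranspose_self A).inv

/-- Full row rank: `A† = A*(AA*)⁻¹`.
[cite: BenIsraelGreville2003, Ch. 1 §6 Thm 5 eq. (19) with F = I] -/
theorem pinv_eq_of_isUnit_self_mul_conjTranspose {A : Matrix m n 𝕜} (h : IsUnit (A * Aᴴ)) :
    pinv A = Aᴴ * (A * Aᴴ)⁻¹ :=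
  (isMoorePenroseInverse_iff_eq_pinv.mp
    (isMoorePenroseInverse_of_isUnit_self_mul_conjTranspose h)).symm

/-- Full row rank: `AA† = I` (the Moore–Penrose inverse is a right inverse).
[cite: BenIsraelGreville2003, Ch. 1 §3 Lemma 2(b)] -/
theorem mul_pinv_self_of_isUnit {A : Matrix m n 𝕜} (h : IsUnit (A * Aᴴ)) : A * pinv A = 1 := by
  rw [pinv_eq_of_isUnit_self_mul_conjTranspose h, ← Matrix.mul_assoc,
    mul_nonsing_inv _ ((isUnit_iff_isUnit_det _).mp h)]

end Row

variable {r : Type*} [Fintype r] [DecidableEq r]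

/-- **MacDuffee / Greville**: for a full-rank factorization `A = FG` (`F*F` and `GG*` nonsingular)
the reverse-order law holds, `(FG)† = G†F†`.
[cite: BenIsraelGreville2003, Ch. 1 §6 Ex. 17 eq. (20), Thm 5 eq. (19)] -/
theorem isMoorePenroseInverse_mul_of_isUnit {F : Matrix m r 𝕜} {G : Matrix r n 𝕜}
    (hF : IsUnit (Fᴴ * F)) (hG : IsUnit (G * Gᴴ)) :
    IsMoorePenroseInverse (F * G) (pinv G * pinv F) := by
  have hFL : pinv F * F = 1 := pinv_mul_self_of_isUnit hF
  have hGR : G * pinv G = 1 := mul_pinv_self_of_isUnit hG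
  have e1 : F * G * (pinv G * pinv F) = F * pinv F := by rw [mul_mid_cancel hGR]
  have e2 : pinv G * pinv F * (F * G) = pinv G * G := by rw [mul_mid_cancel hFL]
  refine ⟨?_, ?_, ?_, ?_⟩
  · rw [e1, mul_mid_cancel hFL]
  · rw [e2, mul_mid_cancel hGR]
  · rw [e1]; exact isHermitian_mul_pinv F
  · rw [e2]; exact isHermitian_pinv_mul G

/-- `(FG)† = G†F†` for a full-rank factorization.
[cite: BenIsraelGreville2003, Ch. 1 §6 Ex. 17 eq. (20)] -/
theorem pinv_mul_of_isUnit {F : Matrix m r 𝕜} {G : Matrix r n 𝕜} (hF : IsUnit (Fᴴ * F))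
    (hG : IsUnit (G * Gᴴ)) : pinv (F * G) = pinv G * pinv F :=
  (isMoorePenroseInverse_iff_eq_pinv.mp (isMoorePenroseInverse_mul_of_isUnit hF hG)).symm

/-- MacDuffee's formula, eq. (19): `(FG)† = G*(GG*)⁻¹(F*F)⁻¹F*`.
[cite: BenIsraelGreville2003, Ch. 1 §6 Thm 5 eq. (19)] -/
theorem pinv_mul_eq_of_isUnit {F : Matrix m r 𝕜} {G : Matrix r n 𝕜} (hF : IsUnit (Fᴴ * F))
    (hG : IsUnit (G * Gᴴ)) : pinv (F * G) = Gᴴ * (G * Gᴴ)⁻¹ * ((Fᴴ * F)⁻¹ * Fᴴ) := by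
  rw [pinv_mul_of_isUnit hF hG, pinv_eq_of_isUnit_self_mul_conjTranspose hG,
    pinv_eq_of_isUnit_conjTranspose_mul_self hF]

/-- **MacDuffee's formula**, eq. (17): `(FG)† = G*(F*(FG)G*)⁻¹F*` (`F*AG* = (F*F)(GG*)` is
nonsingular). [cite: BenIsraelGreville2003, Ch. 1 §6 Thm 5 eqs. (17), (18)] -/
theorem pinv_mul_eq_macduffee {F : Matrix m r 𝕜} {G : Matrix r n 𝕜} (hF : IsUnit (Fᴴ * F))
    (hG : IsUnit (G * Gᴴ)) : pinv (F * G) = Gᴴ * (Fᴴ * (F * G) * Gᴴ)⁻¹ * Fᴴ := by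
  have e : Fᴴ * (F * G) * Gᴴ = Fᴴ * F * (G * Gᴴ) := by simp only [Matrix.mul_assoc]
  rw [pinv_mul_eq_of_isUnit hF hG, e, Matrix.mul_inv_rev]
  simp only [Matrix.mul_assoc]

end FullRank

end Literature.LinearAlgebra.Matrix.MoorePenrose
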